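import Literature.Barriers.HubbardSuperconductivity.HohenbergMerminWagnerPairing
import Literature.MathematicalPhysics.QuantumLattice.HubbardGaugeBoundSharp
import Literature.MathematicalPhysics.QuantumLattice.TorusEuclidLogDipole
import Mathlib.NumberTheory.Harmonic.Bounds
import HarnessLib

/-!
# Koma–Tasaki decay of bond-pair and pair-field correlations with the sharp constants

Trunk T-QLATTICE (family `hubbard`; consumers: the cell file
`Summits/HubbardSuperconductivity/HubbardLadder/Bounds/PairFieldEtaLineEuclid.lean` and the
barrier entry `Literature/Barriers/HubbardSuperconductivity/HohenbergMerminWagnerPairing.lean`,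
whose exponent `pairDecayExponent (β|t|) ≈ 1/(128 β|t|)` this file improves to `1/(π β|t|)`).

Koma–Tasaki (PRL 68 (1992) 3248), footnote [10]: the Theorem (power-law decay
`|⟨P_x† P_y⟩| ≤ |x - y|^{-f(β)}` of pairing correlations at `T > 0` in `d = 2`) "applies to other
pairing operators", in particular to the singlet bond pairs `b_{uv} = c_{u↑}c_{v↓} - c_{u↓}c_{v↑}`
from which the `d_{x²-y²}` pair field `P_x = Σ_e (g e/√2) b_{x,x+e}` of Scalapino (Phys. Rep. 250
(1995) 329, §2) and of the summit is built (Su–Suzuki 1998 treat the `d`-wave case by name). The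
barrier file proves this with the tree's non-sharp ingredients (hopping norm counted twice, radial
`ℓ^∞` monopole with Dirichlet energy `128 q² H(R)`). Here the two sharp ingredients of the tree —
the printed hopping norm `‖c†_u c_v + c†_v c_u‖ ≤ 1` (`HubbardGaugeBoundSharp`) and the explicit
Euclidean truncated logarithmic dipole with the McBryan–Spencer constant `2π`
(`TorusEuclidLogDipole`) — are combined for bond pairs:

* `norm_thermalCorr_bondPair_le_exp_sharp` — the a priori bound
  `|⟨(b_{uv})† b_{wz}⟩_β| ≤ 4 exp[-(φ_u+φ_v)+(φ_w+φ_z)] exp[β|t| Σ_a Σ_b [a∼b](cosh(φ_a-φ_b)-1)]`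
  on an arbitrary finite graph (the barrier's `norm_thermalCorr_bondPair_le_exp` without the
  factor `2` in the exponent), and its torus pull-back for potentials that are flat on the two
  bonds, `norm_thermalCorr_bondPair_torus_le_exp_sharp` (factor `e^{-2(φ_x - φ_y)}`, gauge charge `2`);
* `exists_euclidLogDipole_flat` — the dipole of `exists_euclidLogDipole` (gain `2q log ρ`, energy
  `≤ 2(2πq²H(ρ) + 76q² + 544q⁴e^{2q²})`) is CONSTANT on the unit neighbourhoods
  `{u : |u - x|₂² ≤ 1}` and `{v : |v - y|₂² ≤ 1}` of its two centres (the truncated profile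
  vanishes for `|·|₂² ≤ 1` and the far monopole is saturated there);
* `le_rpow_euclid_of_apriori_flat` — generic step: an a priori bound with gauge charge `c` and
  cost `b`, required only for potentials flat near `x` and `y`, gives
  `g ≤ K 5^f (dist(x,y)+1)^{-f}`, `f = 2cq - 4πbq²`, `K = exp[2b(2πq²+76q²+544q⁴e^{2q²})]`;
* `norm_thermalCorr_bondPair_torus_le_rpow_sharp` — for partners `x', y'` with
  `|x'-x|₂², |y'-y|₂² ≤ 1`: `|⟨(b_{xx'})† b_{yy'}⟩_{β,L}| ≤ 4K(q) 5^f (dist(x,y)+1)^{-f}`,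
  `f = 4q - 4πβ|t|q² ≥ 0`, every `q ≥ 0`, uniformly in `L`, all `U`, `μ`;
* `norm_thermalCorr_localPair_le_sharp` — for EVERY form factor `g`:
  `|⟨(P_x)† P_y⟩_{β,L}| ≤ 4(Σ_e |g e/√2|)² K(q) 5^f (dist(x,y)+1)^{-f}`; at `q = 1/(2πβ|t|)` the
  exponent is `1/(πβ|t|) = T/(π|t|)` — versus the barrier's `pairDecayExponent ≤ 1/(64β|t|)`.

Sources: T. Koma, H. Tasaki, PRL 68 (1992) 3248 (= arXiv:cond-mat/9709068), Theorem, eqs.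
(5)–(13), footnote [10]; O. A. McBryan, T. Spencer, Commun. Math. Phys. 53 (1977) 299;
G. Su, M. Suzuki, PRB 58 (1998) 117; D. J. Scalapino, Phys. Rep. 250 (1995) 329, §2.

## Mathlib / tree search

Tree: `bondPair`, `siteGauge_mul_bondPairCorr_mul`, `norm_bondPairCorr_le_four`,
`thermalCorr_localPair_eq`, `apply_mem_insert_unitSteps`, `torusNorm_proj_le_one`
(`HohenbergMerminWagnerPairing`); `norm_hoppingPerturbation_le_sharp` (`HubbardGaugeBoundSharp`);
`norm_gibbsState_le_of_gauge`, `siteGauge_conj_hamiltonianWith_add_conjTranspose`,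
`isUnit_siteGauge`, `siteGauge_inv`, `isHermitian_hamiltonianWith` (`HubbardGaugeBound`,
`HubbardHubbardModelPairDecayProofs`); `torusNormSq`, `euclidLogProfile`,
`euclidLogMonopole_energy_le` (`TorusEuclidLogDipole`); `torusNorm_two_eq_max`,
`torusDist_triangle'`, `torusDist_comm'`. Mathlib: `harmonic_le_one_add_log`.

## Design notes

No statement of the tree is changed; the sharp lemmas sit next to the existing ones with the
suffix `_sharp` / `_flat`. The flat dipole is rebuilt from the public profile `euclidLogProfile`
(the construction lemmas of `TorusEuclidLogDipole` are private); three one-line profile facts are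
re-proved here under primed names.
-/

noncomputable section

namespace Literature.MathematicalPhysics.QuantumLattice

open Matrix Finset NormedSpace Literature.Probability.LatticeModels
  Literature.Barriers.HubbardSuperconductivity
open scoped Matrix.Norms.L2Operator ComplexOrder

/-! ### The a priori bound for bond pairs with the printed hopping norm -/

section Graph

variable {Λ : Type*} [LinearOrder Λ] [Fintype Λ] (G : SimpleGraph Λ) [DecidableRel G.Adj]

/-- **Koma–Tasaki's a priori bound for bond pairs, printed constant** (eqs. (6)–(12) before the
choice of `φ`, footnote [10]; first inequality of eq. (11) with `‖c†_u c_v + c†_v c_u‖ = 1`): on an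
arbitrary finite graph, for every real site function `φ`, `β ≥ 0` and sites `u, v, w, z`,
`|⟨(b_{uv})† b_{wz}⟩_β| ≤ 4 exp[-(φ_u+φ_v)+(φ_w+φ_z)] exp[β|t| Σ_a Σ_b [a∼b](cosh(φ_a-φ_b)-1)]`.
[cite: KomaTasakiPRL1992, eqs. (6)–(12) and footnote [10]] -/
theorem norm_thermalCorr_bondPair_le_exp_sharp (t U μ : ℝ) {β : ℝ} (hβ : 0 ≤ β) (φ : Λ → ℝ)
    (u v w z : Λ) :
    ‖(hamiltonianWith G t U μ).thermalCorr β (bondPair u v)ᴴ (bondPair w z)‖ ≤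
      4 * Real.exp (-(φ u + φ v) + (φ w + φ z)) *
        Real.exp (β * (|t| * ∑ a : Λ, ∑ b : Λ,
          if G.Adj a b then (Real.cosh (φ a - φ b) - 1) else 0)) := by
  set H : Matrix (Finset (Orb Λ)) (Finset (Orb Λ)) ℂ := hamiltonianWith G t U μ with hH_def
  set A : Matrix (Finset (Orb Λ)) (Finset (Orb Λ)) ℂ := (bondPair u v)ᴴ * bondPair w z
    with hA_def
  set V : Matrix (Finset (Orb Λ)) (Finset (Orb Λ)) ℂ :=
    -(t : ℂ) • hoppingForm G (fun a b => Real.cosh (φ a - φ b) - 1) with hV_def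
  set c : ℝ := |t| * ∑ a : Λ, ∑ b : Λ,
    if G.Adj a b then (Real.cosh (φ a - φ b) - 1) else 0 with hc_def
  set κ : ℝ := Real.exp (-(φ u + φ v) + (φ w + φ z)) with hκ_def
  have hH : H.IsHermitian := isHermitian_hamiltonianWith G t U μ
  have hD : IsUnit (siteGauge φ) := isUnit_siteGauge φ
  have hA : siteGauge φ * A * (siteGauge φ)⁻¹ = ((κ : ℝ) : ℂ) • A := by
    rw [siteGauge_inv]
    exact siteGauge_mul_bondPairCorr_mul φ u v w z
  have hV : siteGauge φ * H * (siteGauge φ)⁻¹ + (siteGauge φ * H * (siteGauge φ)⁻¹)ᴴ =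
      (2 : ℂ) • (H + V) := by
    rw [siteGauge_inv]
    exact siteGauge_conj_hamiltonianWith_add_conjTranspose G φ t U μ
  have hc : ‖V‖ ≤ c := norm_hoppingPerturbation_le_sharp G φ t
  have h := norm_gibbsState_le_of_gauge hH hD hA hV hc hβ
  have hκ : ‖((κ : ℝ) : ℂ)‖ = κ := by
    rw [Complex.norm_real, Real.norm_of_nonneg (Real.exp_pos _).le]
  have hthermal : H.thermalCorr β (bondPair u v)ᴴ (bondPair w z) = gibbsState β H A := rfl
  rw [hthermal]
  calc ‖gibbsState β H A‖
      ≤ ‖((κ : ℝ) : ℂ)‖ * ‖A‖ * Real.exp (β * c) := h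
    _ ≤ ‖((κ : ℝ) : ℂ)‖ * 4 * Real.exp (β * c) := by
        gcongr
        exact norm_bondPairCorr_le_four u v w z
    _ = 4 * κ * Real.exp (β * c) := by rw [hκ]; ring

end Graph

/-! ### Torus pull-back for potentials flat on the two bonds -/

section Torus

variable {L : ℕ} [NeZero L]

/-- **The printed a priori bound on `(ℤ/Lℤ)²` for flat potentials.** If the real site function
`φ` takes the same value at `x'` as at `x` and at `y'` as at `y`, then for `β ≥ 0`
`|⟨(b_{xx'})† b_{yy'}⟩_{β,L}| ≤ 4 e^{-2(φ_x - φ_y)} exp[β|t| Σ_a Σ_b [a∼b](cosh(φ_a-φ_b)-1)]`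
— the bond pair carries gauge charge `2` exactly like the on-site pair.
[cite: KomaTasakiPRL1992, eqs. (6)–(12) and footnote [10]] -/
theorem norm_thermalCorr_bondPair_torus_le_exp_sharp (t U μ : ℝ) {β : ℝ} (hβ : 0 ≤ β)
    (φ : TorusSite 2 L → ℝ) (x x' y y' : TorusSite 2 L) (hx' : φ x' = φ x) (hy' : φ y' = φ y) :
    ‖(hubbardTorusWith 2 L t U μ).thermalCorr β
        (bondPair (FermionTorus.ofTorusSite x) (FermionTorus.ofTorusSite x'))ᴴ
        (bondPair (FermionTorus.ofTorusSite y) (FermionTorus.ofTorusSite y'))‖ ≤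
      4 * (Real.exp (-(2 * (φ x - φ y))) * Real.exp (β * |t| *
        ∑ a : TorusSite 2 L, ∑ b : TorusSite 2 L,
          (if (torusGraph 2 L).Adj a b then (Real.cosh (φ a - φ b) - 1) else 0))) := by
  have key := norm_thermalCorr_bondPair_le_exp_sharp (fermionTorusGraph 2 L) t U μ hβ
    (fun u => φ (FermionTorus.toTorusSite u)) (FermionTorus.ofTorusSite x)
    (FermionTorus.ofTorusSite x') (FermionTorus.ofTorusSite y) (FermionTorus.ofTorusSite y')
  have hsumeq : (∑ u : FermionTorus 2 L, ∑ v : FermionTorus 2 L,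
      if (fermionTorusGraph 2 L).Adj u v then
        (Real.cosh (φ (FermionTorus.toTorusSite u) - φ (FermionTorus.toTorusSite v)) - 1)
      else 0) =
      ∑ a : TorusSite 2 L, ∑ b : TorusSite 2 L,
        if (torusGraph 2 L).Adj a b then (Real.cosh (φ a - φ b) - 1) else 0 := by
    refine Fintype.sum_equiv FermionTorus.equivTorusSite _ _ fun u => ?_
    refine Fintype.sum_equiv FermionTorus.equivTorusSite _ _ fun v => ?_
    simp [FermionTorus.equivTorusSite]
  simp only [FermionTorus.toTorusSite_ofTorusSite] at key
  rw [hsumeq, hx', hy'] at key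
  have h2 : -(φ x + φ x) + (φ y + φ y) = -(2 * (φ x - φ y)) := by ring
  rw [h2] at key
  refine Eq.trans_le ?_ (key.trans_eq ?_)
  · congr!
  · ring

/-! ### The flat Euclidean dipole -/

omit [NeZero L] in
/-- `‖z‖_∞² ≤ |z|₂²`. [folklore] -/
private theorem torusNorm_sq_le_torusNormSq' (z : TorusSite 2 L) :
    torusNorm z ^ 2 ≤ torusNormSq z := by
  rw [torusNorm_two_eq_max, torusNormSq]
  rcases le_total (min (z 0).val (L - (z 0).val)) (min (z 1).val (L - (z 1).val)) with h | h
  · rw [max_eq_right h]; exact Nat.le_add_left _ _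
  · rw [max_eq_left h]; exact Nat.le_add_right _ _

omit [NeZero L] in
/-- `|u - c|₂² ≤ 1 ⟹ dist_∞(u, c) ≤ 1`. [folklore] -/
private theorem torusDist_le_one_of_torusNormSq_le_one {u c : TorusSite 2 L}
    (h : torusNormSq (u - c) ≤ 1) : torusDist u c ≤ 1 := by
  have h2 : torusDist u c ^ 2 ≤ 1 := (torusNorm_sq_le_torusNormSq' (u - c)).trans h
  nlinarith [Nat.zero_le (torusDist u c)]

/-- `g_N(n) = 0` for `n ≤ 1`. [folklore] -/
private theorem euclidLogProfile_of_le_one' (N n : ℕ) (hn : n ≤ 1) : euclidLogProfile N n = 0 := by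
  unfold euclidLogProfile
  have : max 1 (min n N) = 1 := by omega
  rw [this]
  simp

/-- `g_{ρ²}(n) = log ρ` for `ρ² ≤ n`, `ρ ≥ 1`. [folklore] -/
private theorem euclidLogProfile_sat' (ρ n : ℕ) (hρ : 1 ≤ ρ) (hn : ρ ^ 2 ≤ n) :
    euclidLogProfile (ρ ^ 2) n = Real.log ρ := by
  unfold euclidLogProfile
  have h1 : 1 ≤ ρ ^ 2 := Nat.one_le_pow _ _ hρ
  rw [min_eq_right hn, max_eq_right h1]
  push_cast
  rw [Real.log_pow]
  ring

/-- **The flat Euclidean truncated logarithmic dipole.** On `(ℤ/Lℤ)²`, for sites `x, y`, a charge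
`q ≥ 0` and a radius `ρ ≥ 1` with `2ρ + 1 ≤ dist_∞(x,y)`, the dipole `φ = φ^{(y)} - φ^{(x)}`,
`φ^{(c)}(u) = q g_{ρ²}(|u - c|₂²)`, of `exists_euclidLogDipole` (gain `2q log ρ`, energy
`≤ 2(2πq²H(ρ) + 76q² + 544q⁴e^{2q²})`) is moreover constant on the unit `|·|₂`-neighbourhoods of
`x` and of `y`: there `g_{ρ²}(|u - c|₂²) = 0` for the near monopole and the far monopole is
saturated at `q log ρ` (`dist_∞ ≥ 2ρ ≥ ρ`). Koma–Tasaki, PRL 68 (1992) 3248, proof of eq. (13)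
(P1–P2), following McBryan–Spencer (1977). [cite: KomaTasakiPRL1992, proof of eq. (13) (P1–P2)] -/
theorem exists_euclidLogDipole_flat (L : ℕ) [NeZero L] (x y : TorusSite 2 L) (q : ℝ) (hq : 0 ≤ q)
    (ρ : ℕ) (hρ1 : 1 ≤ ρ) (hρ : 2 * ρ + 1 ≤ torusDist x y) :
    ∃ φ : TorusSite 2 L → ℝ, φ x - φ y = 2 * q * Real.log ρ ∧
      (∑ u : TorusSite 2 L, ∑ v : TorusSite 2 L,
          (if (torusGraph 2 L).Adj u v then (Real.cosh (φ u - φ v) - 1) else 0) ≤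
        2 * (2 * Real.pi * q ^ 2 * (harmonic ρ : ℝ) + 76 * q ^ 2 +
          544 * q ^ 4 * Real.exp (2 * q ^ 2))) ∧
      (∀ u : TorusSite 2 L, torusNormSq (u - x) ≤ 1 → φ u = φ x) ∧
      (∀ v : TorusSite 2 L, torusNormSq (v - y) ≤ 1 → φ v = φ y) := by
  classical
  set A : TorusSite 2 L → ℝ := fun u => q * euclidLogProfile (ρ ^ 2) (torusNormSq (u - y))
    with hA
  set B : TorusSite 2 L → ℝ := fun u => q * euclidLogProfile (ρ ^ 2) (torusNormSq (u - x))
    with hB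
  have hsq : ∀ u c : TorusSite 2 L, torusDist u c ^ 2 ≤ torusNormSq (u - c) := fun u c =>
    torusNorm_sq_le_torusNormSq' (u - c)
  have hsat : ∀ u c : TorusSite 2 L, ρ ≤ torusDist u c →
      euclidLogProfile (ρ ^ 2) (torusNormSq (u - c)) = Real.log ρ := by
    intro u c huc
    exact euclidLogProfile_sat' ρ _ hρ1 ((Nat.pow_le_pow_left huc 2).trans (hsq u c))
  have hxy : ρ ≤ torusDist x y := by omega
  have hyx : ρ ≤ torusDist y x := by rw [torusDist_comm']; exact hxy
  have hAx : A x = q * Real.log ρ := by simp only [hA, hsat x y hxy]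
  have hBy : B y = q * Real.log ρ := by simp only [hB, hsat y x hyx]
  have hAy : A y = 0 := by
    simp only [hA, sub_self]
    rw [show torusNormSq (0 : TorusSite 2 L) = 0 by simp [torusNormSq],
      euclidLogProfile_of_le_one' _ _ zero_le_one, mul_zero]
  have hBx : B x = 0 := by
    simp only [hB, sub_self]
    rw [show torusNormSq (0 : TorusSite 2 L) = 0 by simp [torusNormSq],
      euclidLogProfile_of_le_one' _ _ zero_le_one, mul_zero]
  refine ⟨fun u => A u - B u, ?_, ?_, ?_, ?_⟩
  · -- gain
    show (A x - B x) - (A y - B y) = 2 * q * Real.log ρ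
    rw [hAx, hBy, hAy, hBx]
    ring
  · -- energy: bondwise splitting on disjoint supports
    have hsplit : ∀ u v, (torusGraph 2 L).Adj u v →
        Real.cosh ((A u - B u) - (A v - B v)) - 1 =
          (Real.cosh (A u - A v) - 1) + (Real.cosh (B u - B v) - 1) := by
      intro u v huv
      have hre : (A u - B u) - (A v - B v) = (A u - A v) - (B u - B v) := by ring
      rw [hre]
      by_cases hfar : ρ ≤ torusDist u y ∧ ρ ≤ torusDist v y
      · have hA0 : A u - A v = 0 := by
          simp only [hA, hsat u y hfar.1, hsat v y hfar.2, sub_self]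
        rw [hA0, zero_sub, Real.cosh_neg, Real.cosh_zero, sub_self, zero_add]
      · have hd := torusDist_le_of_adj L huv y
        have huy : torusDist u y ≤ ρ := by omega
        have hvy : torusDist v y ≤ ρ := by omega
        have htu := torusDist_triangle' x u y
        have htv := torusDist_triangle' x v y
        rw [torusDist_comm' x u] at htu
        rw [torusDist_comm' x v] at htv
        have hux : ρ ≤ torusDist u x := by omega
        have hvx : ρ ≤ torusDist v x := by omega
        have hB0 : B u - B v = 0 := by
          simp only [hB, hsat u x hux, hsat v x hvx, sub_self]
        rw [hB0, sub_zero, Real.cosh_zero, sub_self, add_zero]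
    have hmonoY := euclidLogMonopole_energy_le L y q hq ρ
    have hmonoX := euclidLogMonopole_energy_le L x q hq ρ
    calc ∑ u : TorusSite 2 L, ∑ v : TorusSite 2 L,
          (if (torusGraph 2 L).Adj u v then (Real.cosh ((A u - B u) - (A v - B v)) - 1) else 0)
        = ∑ u : TorusSite 2 L, ∑ v : TorusSite 2 L,
            ((if (torusGraph 2 L).Adj u v then (Real.cosh (A u - A v) - 1) else 0) +
              (if (torusGraph 2 L).Adj u v then (Real.cosh (B u - B v) - 1) else 0)) := by
          refine sum_congr rfl fun u _ => sum_congr rfl fun v _ => ?_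
          split_ifs with huv
          · exact hsplit u v huv
          · simp
      _ = (∑ u : TorusSite 2 L, ∑ v : TorusSite 2 L,
            (if (torusGraph 2 L).Adj u v then (Real.cosh (A u - A v) - 1) else 0)) +
          ∑ u : TorusSite 2 L, ∑ v : TorusSite 2 L,
            (if (torusGraph 2 L).Adj u v then (Real.cosh (B u - B v) - 1) else 0) := by
          simp only [sum_add_distrib]
      _ ≤ _ := by
          have := add_le_add hmonoY hmonoX
          simpa [hA, hB, two_mul] using this
  · -- flat near `x`
    intro u hu
    have hux1 : torusDist u x ≤ 1 := torusDist_le_one_of_torusNormSq_le_one hu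
    have huy : ρ ≤ torusDist u y := by
      have := torusDist_triangle' x u y
      rw [torusDist_comm' x u] at this
      omega
    have hBu : B u = 0 := by
      simp only [hB]
      rw [euclidLogProfile_of_le_one' _ _ hu, mul_zero]
    have hAu : A u = q * Real.log ρ := by simp only [hA, hsat u y huy]
    show A u - B u = A x - B x
    rw [hAu, hBu, hAx, hBx]
  · -- flat near `y`
    intro v hv
    have hvy1 : torusDist v y ≤ 1 := torusDist_le_one_of_torusNormSq_le_one hv
    have hvx : ρ ≤ torusDist v x := by
      have := torusDist_triangle' x v y
      rw [torusDist_comm' x v] at this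
      omega
    have hAv : A v = 0 := by
      simp only [hA]
      rw [euclidLogProfile_of_le_one' _ _ hv, mul_zero]
    have hBv : B v = q * Real.log ρ := by simp only [hB, hsat v x hvx]
    show A v - B v = A y - B y
    rw [hAv, hBv, hAy, hBy]

/-! ### Generic step: flat a priori bound ⟹ sharp power law on the torus -/

/-- **Euclidean-dipole form of an a priori gauge bound, flat version, parametric in the gauge
charge `c` and the cost constant `b`.** If a quantity `g` obeys
`g ≤ e^{-c(φ_x - φ_y)} exp[b Σ_u Σ_v [u∼v](cosh(φ_u - φ_v) - 1)]` (`b ≥ 0`) for every real site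
function `φ` on `(ℤ/Lℤ)²` that is constant on `{u : |u-x|₂² ≤ 1}` and on `{v : |v-y|₂² ≤ 1}`,
then for every `q ≥ 0` with `f = 2cq - 4πbq² ≥ 0`: `g ≤ K 5^f (dist(x,y)+1)^{-f}`,
`K = exp[2b(2πq² + 76q² + 544q⁴e^{2q²})]` (the flat dipole of radius `ρ = ⌊(dist-1)/2⌋ ≥
(dist+1)/5`, `H(ρ) ≤ 1 + log ρ`; `φ = 0` at distance `≤ 2`). Koma–Tasaki, PRL 68 (1992) 3248,
eqs. (12)–(13). [cite: KomaTasakiPRL1992, eqs. (12)–(13)] -/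
theorem le_rpow_euclid_of_apriori_flat (L : ℕ) [NeZero L] (b c q g f : ℝ) (hb : 0 ≤ b)
    (hq : 0 ≤ q) (x y : TorusSite 2 L)
    (hAP : ∀ φ : TorusSite 2 L → ℝ, (∀ u, torusNormSq (u - x) ≤ 1 → φ u = φ x) →
      (∀ v, torusNormSq (v - y) ≤ 1 → φ v = φ y) →
      g ≤ Real.exp (-(c * (φ x - φ y))) * Real.exp (b *
          ∑ u : TorusSite 2 L, ∑ v : TorusSite 2 L,
            (if (torusGraph 2 L).Adj u v then (Real.cosh (φ u - φ v) - 1) else 0)))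
    (hfq : f = 2 * c * q - 4 * Real.pi * b * q ^ 2) (hf : 0 ≤ f) :
    g ≤ Real.exp (2 * b * (2 * Real.pi * q ^ 2 + 76 * q ^ 2 + 544 * q ^ 4 * Real.exp (2 * q ^ 2))) *
        ((5 : ℝ) ^ f * ((torusDist x y : ℝ) + 1) ^ (-f)) := by
  set K : ℝ := Real.exp (2 * b *
    (2 * Real.pi * q ^ 2 + 76 * q ^ 2 + 544 * q ^ 4 * Real.exp (2 * q ^ 2))) with hK
  have hK1 : 1 ≤ K := Real.one_le_exp (by positivity)
  set R : ℕ := torusDist x y with hR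
  have hR1 : (0 : ℝ) < (R : ℝ) + 1 := by positivity
  by_cases hR3 : R < 3
  · have h0 := hAP (fun _ => 0) (fun _ _ => rfl) (fun _ _ => rfl)
    simp only [sub_self, mul_zero, neg_zero, Real.cosh_zero, ite_self, sum_const_zero,
      Real.exp_zero, mul_one] at h0
    have hge1 : 1 ≤ (5 : ℝ) ^ f * ((R : ℝ) + 1) ^ (-f) := by
      rw [Real.rpow_neg hR1.le, ← div_eq_mul_inv, ← Real.div_rpow (by norm_num) hR1.le]
      refine Real.one_le_rpow ?_ hf
      rw [le_div_iff₀ hR1]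
      have : (R : ℝ) ≤ 2 := by exact_mod_cast (by omega : R ≤ 2)
      linarith
    calc g ≤ 1 := h0
      _ ≤ K * ((5 : ℝ) ^ f * ((R : ℝ) + 1) ^ (-f)) := by nlinarith
  · have hR3' : 3 ≤ R := not_lt.1 hR3
    set ρ : ℕ := (R - 1) / 2 with hρdef
    have hρ1 : 1 ≤ ρ := by omega
    have hρR : 2 * ρ + 1 ≤ torusDist x y := by rw [← hR]; omega
    have h5ρ : R + 1 ≤ 5 * ρ := by omega
    obtain ⟨φ, hgain, hE, hfx, hfy⟩ := exists_euclidLogDipole_flat L x y q hq ρ hρ1 hρR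
    have key := hAP φ hfx hfy
    rw [hgain] at key
    have hρ0 : (0 : ℝ) < (ρ : ℝ) := by exact_mod_cast hρ1
    have hH : (harmonic ρ : ℝ) ≤ 1 + Real.log ρ := harmonic_le_one_add_log ρ
    have hfifth : ((R : ℝ) + 1) / 5 ≤ (ρ : ℝ) := by
      have h' : ((R : ℝ) + 1) ≤ 5 * (ρ : ℝ) := by exact_mod_cast h5ρ
      linarith
    have hfifth0 : (0 : ℝ) < ((R : ℝ) + 1) / 5 := by positivity
    calc g ≤ Real.exp (-(c * (2 * q * Real.log ρ))) * Real.exp (b *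
            ∑ u : TorusSite 2 L, ∑ v : TorusSite 2 L,
              (if (torusGraph 2 L).Adj u v then (Real.cosh (φ u - φ v) - 1) else 0)) := key
      _ ≤ Real.exp (-(c * (2 * q * Real.log ρ))) * Real.exp (b *
            (2 * (2 * Real.pi * q ^ 2 * (harmonic ρ : ℝ) + 76 * q ^ 2 +
              544 * q ^ 4 * Real.exp (2 * q ^ 2)))) := by
          gcongr
      _ ≤ Real.exp (-(c * (2 * q * Real.log ρ))) * Real.exp (b *
            (2 * (2 * Real.pi * q ^ 2 * (1 + Real.log ρ) + 76 * q ^ 2 +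
              544 * q ^ 4 * Real.exp (2 * q ^ 2)))) := by
          gcongr
      _ = K * Real.exp (-(f * Real.log ρ)) := by
          rw [hK, ← Real.exp_add, ← Real.exp_add, hfq]
          congr 1
          ring
      _ = K * (ρ : ℝ) ^ (-f) := by
          rw [Real.rpow_def_of_pos hρ0]
          congr 2
          ring
      _ ≤ K * (((R : ℝ) + 1) / 5) ^ (-f) := by
          gcongr K * ?_
          exact Real.rpow_le_rpow_of_nonpos hfifth0 hfifth (by linarith)
      _ = K * ((5 : ℝ) ^ f * ((R : ℝ) + 1) ^ (-f)) := by
          rw [Real.div_rpow hR1.le (by norm_num), Real.rpow_neg (by norm_num : (0:ℝ) ≤ 5),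
            div_inv_eq_mul, mul_comm (((R : ℝ) + 1) ^ (-f))]

/-! ### The sharp power laws for bond pairs and pair fields -/

/-- **Sharp Koma–Tasaki bound for bond pairs on `(ℤ/Lℤ)²`** (Theorem, eq. (2), in the generality
of footnote [10], with the printed hopping norm and the Euclidean dipole): for all real `t, U, μ`,
`β ≥ 0`, every `q ≥ 0` with `f := 4q - 4πβ|t|q² ≥ 0`, all sites `x, y` and partner sites
`x', y'` with `|x'-x|₂² ≤ 1`, `|y'-y|₂² ≤ 1`:
`|⟨(b_{xx'})† b_{yy'}⟩_{β,L}| ≤ 4 K(q) 5^f (dist(x,y)+1)^{-f}`,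
`K(q) = exp[2β|t|(2πq² + 76q² + 544q⁴e^{2q²})]`, uniformly in `L`; at `q = 1/(2πβ|t|)`,
`f = 1/(πβ|t|)`. [cite: KomaTasakiPRL1992, Theorem eq. (2), footnote [10], eqs. (5)–(13)] -/
theorem norm_thermalCorr_bondPair_torus_le_rpow_sharp (L : ℕ) [NeZero L] (t U μ β q : ℝ)
    (hβ : 0 ≤ β) (hq : 0 ≤ q) (hf : 0 ≤ 4 * q - 4 * Real.pi * (β * |t|) * q ^ 2)
    (x x' y y' : TorusSite 2 L) (hx' : torusNormSq (x' - x) ≤ 1)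
    (hy' : torusNormSq (y' - y) ≤ 1) :
    ‖(hubbardTorusWith 2 L t U μ).thermalCorr β
        (bondPair (FermionTorus.ofTorusSite x) (FermionTorus.ofTorusSite x'))ᴴ
        (bondPair (FermionTorus.ofTorusSite y) (FermionTorus.ofTorusSite y'))‖ ≤
      4 * (Real.exp (2 * (β * |t|) *
          (2 * Real.pi * q ^ 2 + 76 * q ^ 2 + 544 * q ^ 4 * Real.exp (2 * q ^ 2))) *
        ((5 : ℝ) ^ (4 * q - 4 * Real.pi * (β * |t|) * q ^ 2) *
          ((torusDist x y : ℝ) + 1) ^ (-(4 * q - 4 * Real.pi * (β * |t|) * q ^ 2)))) := by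
  set g : ℝ := ‖(hubbardTorusWith 2 L t U μ).thermalCorr β
        (bondPair (FermionTorus.ofTorusSite x) (FermionTorus.ofTorusSite x'))ᴴ
        (bondPair (FermionTorus.ofTorusSite y) (FermionTorus.ofTorusSite y'))‖ with hg
  have h4 : g / 4 ≤ Real.exp (2 * (β * |t|) *
          (2 * Real.pi * q ^ 2 + 76 * q ^ 2 + 544 * q ^ 4 * Real.exp (2 * q ^ 2))) *
        ((5 : ℝ) ^ (4 * q - 4 * Real.pi * (β * |t|) * q ^ 2) *
          ((torusDist x y : ℝ) + 1) ^ (-(4 * q - 4 * Real.pi * (β * |t|) * q ^ 2))) := by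
    refine le_rpow_euclid_of_apriori_flat L (β * |t|) 2 q (g / 4) _
      (mul_nonneg hβ (abs_nonneg t)) hq x y (fun φ hfx hfy => ?_) (by ring) hf
    rw [div_le_iff₀ (by norm_num : (0 : ℝ) < 4)]
    have := norm_thermalCorr_bondPair_torus_le_exp_sharp t U μ hβ φ x x' y y' (hfx x' hx')
      (hfy y' hy')
    calc g ≤ _ := this
      _ = _ := by ring
  linarith

/-- For a step `e ∈ {0, ±e₁, ±e₂}`, `|proj e|₂² ≤ 1` on `(ℤ/Lℤ)²` (one coordinate of `e`
vanishes, the other has cyclic absolute value `≤ 1`). [folklore] -/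
private theorem torusNormSq_proj_le_one (L : ℕ) [NeZero L] {e : Site 2}
    (he : e ∈ insert (0 : Site 2) unitSteps) : torusNormSq (Torus.proj L e) ≤ 1 := by
  have hmax : torusNorm (Torus.proj L e : TorusSite 2 L) ≤ 1 :=
    torusNorm_proj_le_one L (apply_mem_insert_unitSteps he)
  rw [torusNorm_two_eq_max] at hmax
  have h0 : min ((Torus.proj L e : TorusSite 2 L) 0).val
      (L - ((Torus.proj L e : TorusSite 2 L) 0).val) ≤ 1 := le_trans (le_max_left _ _) hmax
  have h1 : min ((Torus.proj L e : TorusSite 2 L) 1).val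
      (L - ((Torus.proj L e : TorusSite 2 L) 1).val) ≤ 1 := le_trans (le_max_right _ _) hmax
  have hz : e 0 = 0 ∨ e 1 = 0 := by
    simp only [unitSteps, mem_insert, mem_singleton] at he
    rcases he with rfl | rfl | rfl | rfl | rfl <;> simp
  unfold torusNormSq
  rcases hz with h | h
  · have hc : ((Torus.proj L e : TorusSite 2 L) 0) = 0 := by simp [Torus.proj_apply, h]
    have hm0 : min (0 : ℕ) (L - 0) = 0 := by simp
    rw [hc, ZMod.val_zero, hm0]
    simpa using Nat.pow_le_pow_left h1 2
  · have hc : ((Torus.proj L e : TorusSite 2 L) 1) = 0 := by simp [Torus.proj_apply, h]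
    have hm0 : min (0 : ℕ) (L - 0) = 0 := by simp
    rw [hc, ZMod.val_zero, hm0]
    simpa using Nat.pow_le_pow_left h0 2

/-- **Sharp power-law decay of thermal pair-field correlations in two dimensions, EVERY form
factor** (Koma–Tasaki's Theorem in the generality of footnote [10]; the `d_{x²-y²}` case is the
content of Su–Suzuki's title): for every `g : ℤ² → ℝ`, all real `t, U, μ`, `β ≥ 0`, every
`q ≥ 0` with `f := 4q - 4πβ|t|q² ≥ 0`, uniformly in the side `L`:
`|⟨(P_x)† P_y⟩_{β,L}| ≤ 4 (Σ_{e∈{0,±e₁,±e₂}} |g e/√2|)² K(q) 5^f (dist(x,y)+1)^{-f}` — exponent up to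
`1/(πβ|t|) = T/(π|t|)` (McBryan–Spencer's), versus `pairDecayExponent ≤ 1/(64β|t|)` of
`norm_thermalCorr_localPair_le`. [cite: KomaTasakiPRL1992, Theorem eq. (2) and footnote [10]]
[cite: SuSuzuki1998, abstract] -/
theorem norm_thermalCorr_localPair_le_sharp (L : ℕ) [NeZero L] (g : Site 2 → ℝ)
    (t U μ β q : ℝ) (hβ : 0 ≤ β) (hq : 0 ≤ q)
    (hf : 0 ≤ 4 * q - 4 * Real.pi * (β * |t|) * q ^ 2) (x y : TorusSite 2 L) :
    ‖(hubbardTorusWith 2 L t U μ).thermalCorr β (localPair g L x)ᴴ (localPair g L y)‖ ≤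
      4 * (∑ e ∈ insert (0 : Site 2) unitSteps, |g e / Real.sqrt 2|) ^ 2 *
        (Real.exp (2 * (β * |t|) *
            (2 * Real.pi * q ^ 2 + 76 * q ^ 2 + 544 * q ^ 4 * Real.exp (2 * q ^ 2))) *
          ((5 : ℝ) ^ (4 * q - 4 * Real.pi * (β * |t|) * q ^ 2) *
            ((torusDist x y : ℝ) + 1) ^ (-(4 * q - 4 * Real.pi * (β * |t|) * q ^ 2)))) := by
  set D : ℝ := Real.exp (2 * (β * |t|) *
            (2 * Real.pi * q ^ 2 + 76 * q ^ 2 + 544 * q ^ 4 * Real.exp (2 * q ^ 2))) *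
          ((5 : ℝ) ^ (4 * q - 4 * Real.pi * (β * |t|) * q ^ 2) *
            ((torusDist x y : ℝ) + 1) ^ (-(4 * q - 4 * Real.pi * (β * |t|) * q ^ 2))) with hD
  have hD0 : 0 ≤ D := by positivity
  set S : Finset (Site 2) := insert (0 : Site 2) unitSteps with hS
  set a : Site 2 → ℝ := fun e => g e / Real.sqrt 2 with ha
  rw [thermalCorr_localPair_eq]
  have hterm : ∀ e ∈ S, ∀ e' ∈ S,
      ‖((a e : ℝ) : ℂ) * ((a e' : ℝ) : ℂ) *
        (hubbardTorusWith 2 L t U μ).thermalCorr β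
          (bondPair (FermionTorus.ofTorusSite x)
            (FermionTorus.ofTorusSite (x + Torus.proj L e)))ᴴ
          (bondPair (FermionTorus.ofTorusSite y)
            (FermionTorus.ofTorusSite (y + Torus.proj L e')))‖ ≤
        |a e| * |a e'| * (4 * D) := by
    intro e he e' he'
    rw [norm_mul, norm_mul, Complex.norm_real, Complex.norm_real, Real.norm_eq_abs,
      Real.norm_eq_abs]
    refine mul_le_mul_of_nonneg_left ?_ (by positivity)
    refine norm_thermalCorr_bondPair_torus_le_rpow_sharp L t U μ β q hβ hq hf x _ y _ ?_ ?_
    · rw [add_sub_cancel_left]; exact torusNormSq_proj_le_one L he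
    · rw [add_sub_cancel_left]; exact torusNormSq_proj_le_one L he'
  calc ‖∑ e ∈ S, ∑ e' ∈ S, ((a e : ℝ) : ℂ) * ((a e' : ℝ) : ℂ) *
        (hubbardTorusWith 2 L t U μ).thermalCorr β
          (bondPair (FermionTorus.ofTorusSite x)
            (FermionTorus.ofTorusSite (x + Torus.proj L e)))ᴴ
          (bondPair (FermionTorus.ofTorusSite y)
            (FermionTorus.ofTorusSite (y + Torus.proj L e')))‖
      ≤ ∑ e ∈ S, ∑ e' ∈ S, |a e| * |a e'| * (4 * D) := by
        refine (norm_sum_le _ _).trans (Finset.sum_le_sum fun e he => ?_)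
        exact (norm_sum_le _ _).trans (Finset.sum_le_sum fun e' he' => hterm e he e' he')
    _ = 4 * (∑ e ∈ S, |a e|) ^ 2 * D := by
        rw [sq, Finset.sum_mul_sum, Finset.mul_sum, Finset.sum_mul]
        refine Finset.sum_congr rfl fun e _ => ?_
        rw [Finset.mul_sum, Finset.sum_mul]
        refine Finset.sum_congr rfl fun e' _ => ?_
        ring

/-- The a priori bound with `φ = 0`: `|⟨(P_x)† P_y⟩_{β,L}| ≤ 4(Σ_e |g e/√2|)²` for every side,
`β ≥ 0` and all `t, U, μ` (Koma–Tasaki's eq. (12) at `φ = 0`, i.e. boundedness of states; for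
`dWaveFormFactor` the constant is `32`). [cite: KomaTasakiPRL1992, eq. (12) and footnote [10]] -/
theorem norm_thermalCorr_localPair_le_apriori (L : ℕ) [NeZero L] (g : Site 2 → ℝ)
    (t U μ β : ℝ) (hβ : 0 ≤ β) (x y : TorusSite 2 L) :
    ‖(hubbardTorusWith 2 L t U μ).thermalCorr β (localPair g L x)ᴴ (localPair g L y)‖ ≤
      4 * (∑ e ∈ insert (0 : Site 2) unitSteps, |g e / Real.sqrt 2|) ^ 2 := by
  have h := norm_thermalCorr_localPair_le_sharp L g t U μ β 0 hβ le_rfl (by norm_num) x y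
  simp only [mul_zero, zero_pow (two_ne_zero), zero_pow (by norm_num : 4 ≠ 0), add_zero,
    Real.exp_zero, sub_zero, Real.rpow_zero, neg_zero, mul_one] at h
  simpa using h

end Torus

end Literature.MathematicalPhysics.QuantumLattice

end
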